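import Mathlib
import HarnessLib
import Summits.AtomisticToContinuum.Crystallization.Theorems.PricedLinkCensusSoftFourRingsPathGap

/-!
# No link vertex of type `(3,3,3,4)`: three triangles and a quadrilateral around a site

Route `PricedLinkCensus`, item `SoftFourRings` (stmt-AtomisticToContinuum-14234), blueprint step 3(B)
(evidence `softrings-search.md` §3, §7), unit-vector form with general window constants and the
`η = 1/100` instance.  A site direction `v ∈ S²`, four neighbour directions `w k` with
`cb ≤ ⟪v, w k⟫ ≤ ca`, pairwise `⟪w i, w j⟫ ≤ ca`, bonded along the path `w₀ ∼ w₁ ∼ w₂ ∼ w₃`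
(`cb ≤ ⟪w k, w (k+1)⟫`, `k = 0, 1, 2`), and a further direction `x` with `⟪v, x⟫ ≤ ca` bonded to
`w₀` and `w₃`: impossible as soon as the *sharp* corner cosine
`K = (cb − ca²)/(1 − ca²)` (the cosine of the largest tangent angle at `v` subtended by a bonded
pair — attained by the isosceles spherical triangle with two shortest legs and the longest base)
exceeds `cos (2π/5)`: the three triangle corners are `≤ arccos K`, the corner bridged by `x` is
`≤ 2 arccos K`, and `5 arccos K < 2π` (`PricedLinkCensusSoftFourRingsPathGap.four_path_false`).
At `η = 1/100`: `K = 0.31079 > cos 72° = 0.30902`, i.e. `71.893° · 5 = 359.47° < 360°`.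

This is the order-free form of "no `(3,3,3,4)` vertex"; together with `no_bonded_four_cycle`
("no `(3,3,3,3)` vertex") it excludes eleven of the twelve exotic 4-regular planar link types on
twelve vertices (all but the hexagonal antiprism), by a graph search recorded in the evidence file.
-/

namespace Summit.AtomisticToContinuum.Crystallization.Theorems

open Real RealInnerProductSpace

/-- **Tangent polar coordinates.**  For a unit vector `v ∈ ℝ³` and unit vectors `u i`, there are
`ρ i ≥ 0` and angles `θ i ∈ (−π, π]` with `ρ i ² = 1 − ⟪v, u i⟫²` and
`⟪u i, u j⟫ = ρ i ρ j cos (θ i − θ j) + ⟪v, u i⟫ ⟪v, u j⟫` (the spherical law of cosines at `v`).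
[folklore] -/
theorem tangent_polar {ι : Type*} {v : EuclideanSpace ℝ (Fin 3)} (hv : ‖v‖ = 1)
    (u : ι → EuclideanSpace ℝ (Fin 3)) (hu : ∀ i, ‖u i‖ = 1) :
    ∃ ρ θ : ι → ℝ, (∀ i, 0 ≤ ρ i) ∧ (∀ i, ρ i ^ 2 = 1 - ⟪v, u i⟫ ^ 2) ∧
      (∀ i, -π < θ i ∧ θ i ≤ π) ∧
      ∀ i j, ⟪u i, u j⟫ = ρ i * ρ j * cos (θ i - θ j) + ⟪v, u i⟫ * ⟪v, u j⟫ := by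
  obtain ⟨b, hb⟩ := exists_orthonormalBasis_third_eq_unit hv
  set X : ι → ℝ := fun k => ⟪b 0, u k⟫ with hXdef
  set Y : ι → ℝ := fun k => ⟪b 1, u k⟫ with hYdef
  set c : ι → ℝ := fun k => ⟪v, u k⟫ with hcdef
  have hZ : ∀ k, ⟪b 2, u k⟫ = c k := fun k => by simp only [hcdef, hb]
  have hXY : ∀ k, X k ^ 2 + Y k ^ 2 = 1 - c k ^ 2 := by
    intro k
    have h4 : ⟪u k, u k⟫ = 1 := by rw [real_inner_self_eq_norm_sq, hu k]; norm_num
    rw [Literature.Geometry.DiscreteGeometry.inner_eq_sum_three b, hZ k] at h4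
    simp only [hXdef, hYdef]
    nlinarith [h4]
  set ρ : ι → ℝ := fun k => ‖(⟨X k, Y k⟩ : ℂ)‖ with hρdef
  set θ : ι → ℝ := fun k => Complex.arg ⟨X k, Y k⟩ with hθdef
  have hcos : ∀ i j, X i * X j + Y i * Y j = ρ i * ρ j * cos (θ i - θ j) := by
    intro i j
    have hXi : X i = ρ i * cos (θ i) := (polar_form (X i) (Y i)).1
    have hYi : Y i = ρ i * sin (θ i) := (polar_form (X i) (Y i)).2.1
    have hXj : X j = ρ j * cos (θ j) := (polar_form (X j) (Y j)).1
    have hYj : Y j = ρ j * sin (θ j) := (polar_form (X j) (Y j)).2.1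
    rw [cos_sub]
    linear_combination X j * hXi + ρ i * cos (θ i) * hXj + Y j * hYi + ρ i * sin (θ i) * hYj
  refine ⟨ρ, θ, fun k => norm_nonneg _, fun k => ?_,
    fun k => ⟨Complex.neg_pi_lt_arg _, Complex.arg_le_pi _⟩, fun i j => ?_⟩
  · rw [← hXY k]; exact (polar_form (X k) (Y k)).2.2
  · rw [Literature.Geometry.DiscreteGeometry.inner_eq_sum_three b, hZ i, hZ j, ← hcos i j]

/-- **The sharp corner bound.**  Let `0 < cb`, `ca < 1`, `ca² < cb` and `K (1 − ca²) = cb − ca²`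
(so `K = (cb − ca²)/(1 − ca²) ∈ (0, 1]`), with the side condition
`K² ca² (1 − cb²) ≤ cb² (1 − ca²)`.  If `p = cos φ ∈ [cb, ca]`, `q = cos ψ ≤ ca`,
`s = sin φ, t = sin ψ ≥ 0` and the spherical law of cosines gives a bonded pair,
`cb ≤ p q + s t c` with `c` the cosine of the angle at the pole, then `K ≤ c`: the angle at `v`
subtended by a bonded pair is at most `arccos K`, with equality for legs `arccos ca` and base
`arccos cb`.  (Monotonicity: `p q + K s t` increases in `q ≤ ca` and then in `p ≤ ca`, where it
equals `cb`.) [folklore] -/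
theorem corner_cos_lower {ca cb K p q s t c : ℝ} (hcb0 : 0 < cb) (hca1 : ca < 1)
    (hsq : ca ^ 2 < cb) (hK : K * (1 - ca ^ 2) = cb - ca ^ 2)
    (hKs : K ^ 2 * ca ^ 2 * (1 - cb ^ 2) ≤ cb ^ 2 * (1 - ca ^ 2))
    (hp : cb ≤ p) (hp' : p ≤ ca) (hq : q ≤ ca) (hs0 : 0 ≤ s) (hs : s ^ 2 = 1 - p ^ 2)
    (ht0 : 0 ≤ t) (ht : t ^ 2 = 1 - q ^ 2) (hbond : cb ≤ p * q + s * t * c) : K ≤ c := by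
  have hp0 : 0 < p := hcb0.trans_le hp
  have hca0 : 0 < ca := hp0.trans_le hp'
  have h1ca : 0 < 1 - ca ^ 2 := by nlinarith
  have hK0 : 0 < K := by
    by_contra h
    have h' : K ≤ 0 := not_lt.mp h
    have := mul_le_mul_of_nonneg_right h' h1ca.le
    rw [hK, zero_mul] at this
    linarith
  have hK1 : K ≤ 1 := by
    by_contra h
    have h' : 1 < K := not_le.mp h
    have := mul_lt_mul_of_pos_right h' h1ca
    rw [hK, one_mul] at this
    linarith
  obtain ⟨sa, hsa0, hsa2⟩ : ∃ sa : ℝ, 0 < sa ∧ sa ^ 2 = 1 - ca ^ 2 :=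
    ⟨Real.sqrt (1 - ca ^ 2), Real.sqrt_pos.2 h1ca, Real.sq_sqrt h1ca.le⟩
  have hcb : cb = ca ^ 2 + K * sa ^ 2 := by rw [hsa2]; linarith
  -- `sa ≤ s` because `p ≤ ca`
  have hs_sa : sa ≤ s := by
    have : sa ^ 2 ≤ s ^ 2 := by rw [hsa2, hs]; nlinarith [mul_le_mul hp' hp' hp0.le hca0.le]
    exact (pow_le_pow_iff_left₀ hsa0.le hs0 two_ne_zero).1 this
  -- step 2: at `q = ca` the expression is at most `cb`, i.e. `K sa (s - sa) ≤ ca (ca - p)`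
  have step2 : p * ca + K * s * sa ≤ cb := by
    have e1 : (s - sa) * (s + sa) = (ca - p) * (ca + p) := by linear_combination hs - hsa2
    have e2 : sa * (s - sa) ≤ ca * (ca - p) := by
      nlinarith [e1, sq_nonneg (s - sa), sq_nonneg (ca - p)]
    have e3 : K * (sa * (s - sa)) ≤ ca * (ca - p) :=
      calc K * (sa * (s - sa)) ≤ K * (ca * (ca - p)) := mul_le_mul_of_nonneg_left e2 hK0.le
        _ ≤ 1 * (ca * (ca - p)) :=
            mul_le_mul_of_nonneg_right hK1 (mul_nonneg hca0.le (by linarith))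
        _ = ca * (ca - p) := one_mul _
    have : cb - (p * ca + K * s * sa) = ca * (ca - p) - K * (sa * (s - sa)) := by
      rw [hcb]; ring
    linarith
  -- step 1: the expression increases in `q ≤ ca`, i.e. `K s (t - sa) ≤ p (ca - q)`
  have step1 : p * q + K * s * t ≤ p * ca + K * s * sa := by
    rcases le_or_gt t sa with hle | hlt
    · nlinarith [mul_le_mul_of_nonneg_left hle (mul_nonneg hK0.le hs0),
        mul_le_mul_of_nonneg_left hq hp0.le]
    · have e1 : (t - sa) * (t + sa) = (ca - q) * (ca + q) := by linear_combination ht - hsa2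
      -- `K s ca ≤ p sa`, from the side condition on the constants
      have hKs' : K * s * ca ≤ p * sa := by
        have hp2 : cb ^ 2 ≤ p ^ 2 := by nlinarith
        have h1 : (K * s * ca) ^ 2 ≤ (p * sa) ^ 2 := by
          rw [mul_pow, mul_pow, mul_pow, hs, hsa2]
          have hA : K ^ 2 * (1 - p ^ 2) * ca ^ 2 ≤ K ^ 2 * ca ^ 2 * (1 - cb ^ 2) := by
            have := mul_le_mul_of_nonneg_left hp2 (mul_nonneg (sq_nonneg K) (sq_nonneg ca))
            linarith
          have hB : cb ^ 2 * (1 - ca ^ 2) ≤ p ^ 2 * (1 - ca ^ 2) :=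
            mul_le_mul_of_nonneg_right hp2 h1ca.le
          linarith
        exact (pow_le_pow_iff_left₀ (by positivity) (by positivity) two_ne_zero).1 h1
      have hpos : 0 < t + sa := by linarith
      have hcq : 0 ≤ ca - q := by linarith
      have key : K * s * (t - sa) * (t + sa) ≤ p * (ca - q) * (t + sa) :=
        calc K * s * (t - sa) * (t + sa) = K * s * ((ca - q) * (ca + q)) := by
              rw [mul_assoc, e1]
          _ ≤ K * s * ((ca - q) * (2 * ca)) := by
              apply mul_le_mul_of_nonneg_left _ (mul_nonneg hK0.le hs0)
              exact mul_le_mul_of_nonneg_left (by linarith) hcq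
          _ = 2 * (ca - q) * (K * s * ca) := by ring
          _ ≤ 2 * (ca - q) * (p * sa) := mul_le_mul_of_nonneg_left hKs' (by linarith)
          _ ≤ p * (ca - q) * (t + sa) := by
              linarith [mul_nonneg (mul_nonneg hp0.le hcq) (sub_nonneg.2 hlt.le)]
      have := le_of_mul_le_mul_right key hpos
      linarith [this]
  -- conclusion
  by_contra hc
  have hc' : c < K := not_le.mp hc
  rcases (mul_nonneg hs0 ht0).eq_or_lt with h0 | hpos
  · rw [← h0, zero_mul, add_zero] at hbond
    have := mul_le_mul_of_nonneg_left hq hp0.le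
    have := mul_le_mul_of_nonneg_right hp' hca0.le
    nlinarith
  · have : s * t * c < s * t * K := mul_lt_mul_of_pos_left hc' hpos
    linarith [step1, step2]

/-- **No site has three triangles and a bridged fourth corner among its neighbours** (unit-vector
form, general constants).  Let `0 < cb ≤ ca < 1`, `ca² < cb`, `K (1 − ca²) = cb − ca²`,
`K² ca² (1 − cb²) ≤ cb² (1 − ca²)`, `σ₁ = (ca − cb²)/(1 − ca²) < 1/2`, `2σ₁² − 1 < K` and
`cos (2π/5) < K`.  Then there are no unit vectors `v, w₀, …, w₃, x` of `ℝ³` with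
`cb ≤ ⟪v, w k⟫ ≤ ca`, `⟪w i, w j⟫ ≤ ca` (`i ≠ j`), `cb ≤ ⟪w₀, w₁⟫, ⟪w₁, w₂⟫, ⟪w₂, w₃⟫`,
`⟪v, x⟫ ≤ ca` and `cb ≤ ⟪w₀, x⟫, ⟪w₃, x⟫`. [folklore] -/
theorem no_three_triangles_quad {ca cb K : ℝ} (hcb0 : 0 < cb) (hcba : cb ≤ ca) (hca1 : ca < 1)
    (hsq : ca ^ 2 < cb) (hK : K * (1 - ca ^ 2) = cb - ca ^ 2)
    (hKs : K ^ 2 * ca ^ 2 * (1 - cb ^ 2) ≤ cb ^ 2 * (1 - ca ^ 2))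
    (hσ : (ca - cb ^ 2) / (1 - ca ^ 2) < 1 / 2)
    (hσK : 2 * ((ca - cb ^ 2) / (1 - ca ^ 2)) ^ 2 - 1 < K) (hK5 : cos (2 * π / 5) < K)
    {v : EuclideanSpace ℝ (Fin 3)} (hv : ‖v‖ = 1) (w : Fin 4 → EuclideanSpace ℝ (Fin 3))
    (hw : ∀ k, ‖w k‖ = 1) (x : EuclideanSpace ℝ (Fin 3)) (hx : ‖x‖ = 1)
    (hvw : ∀ k, cb ≤ ⟪v, w k⟫ ∧ ⟪v, w k⟫ ≤ ca) (hsep : ∀ i j, i ≠ j → ⟪w i, w j⟫ ≤ ca)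
    (h01 : cb ≤ ⟪w 0, w 1⟫) (h12 : cb ≤ ⟪w 1, w 2⟫) (h23 : cb ≤ ⟪w 2, w 3⟫)
    (hvx : ⟪v, x⟫ ≤ ca) (hx0 : cb ≤ ⟪w 0, x⟫) (hx3 : cb ≤ ⟪w 3, x⟫) : False := by
  set σ₁ := (ca - cb ^ 2) / (1 - ca ^ 2) with hσ₁
  have hca0 : 0 < ca := hcb0.trans_le hcba
  have h1ca : 0 < 1 - ca ^ 2 := by nlinarith
  have hσ0 : 0 ≤ σ₁ := div_nonneg (by nlinarith) h1ca.le
  have hK0 : 0 < K := by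
    by_contra h
    have h' : K ≤ 0 := not_lt.mp h
    have := mul_le_mul_of_nonneg_right h' h1ca.le
    rw [hK, zero_mul] at this
    linarith
  have hK1 : K ≤ 1 := by
    by_contra h
    have h' : 1 < K := not_le.mp h
    have := mul_lt_mul_of_pos_right h' h1ca
    rw [hK, one_mul] at this
    linarith
  -- tangent polar coordinates of the five directions `w 0, …, w 3, x`
  obtain ⟨ρ, θ, hρ0, hρsq, hθ, hinner⟩ :=
    tangent_polar hv (Sum.elim w fun _ : Unit => x) (by rintro (k | _) <;> simp [hw, hx])
  have hρw : ∀ k, ρ (Sum.inl k) ^ 2 = 1 - ⟪v, w k⟫ ^ 2 := fun k => by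
    have := hρsq (Sum.inl k); simp only [Sum.elim_inl] at this; exact this
  have hρx : ρ (Sum.inr ()) ^ 2 = 1 - ⟪v, x⟫ ^ 2 := by
    have := hρsq (Sum.inr ()); simp only [Sum.elim_inr] at this; exact this
  have hww : ∀ i j, ⟪w i, w j⟫ = ρ (Sum.inl i) * ρ (Sum.inl j) *
      cos (θ (Sum.inl i) - θ (Sum.inl j)) + ⟪v, w i⟫ * ⟪v, w j⟫ := fun i j => by
    have := hinner (Sum.inl i) (Sum.inl j); simp only [Sum.elim_inl] at this; exact this
  have hwx : ∀ i, ⟪w i, x⟫ = ρ (Sum.inl i) * ρ (Sum.inr ()) *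
      cos (θ (Sum.inl i) - θ (Sum.inr ())) + ⟪v, w i⟫ * ⟪v, x⟫ := fun i => by
    have := hinner (Sum.inl i) (Sum.inr ()); simp only [Sum.elim_inl, Sum.elim_inr] at this
    exact this
  have hcb_le : ∀ k, cb ≤ ⟪v, w k⟫ := fun k => (hvw k).1
  have hc_le : ∀ k, ⟪v, w k⟫ ≤ ca := fun k => (hvw k).2
  have hc0 : ∀ k, 0 ≤ ⟪v, w k⟫ := fun k => hcb0.le.trans (hcb_le k)
  -- separation in the tangent circle (crude bound): `cos (θ i - θ j) ≤ σ₁`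
  have hρρlo : ∀ i j, 1 - ca ^ 2 ≤ ρ (Sum.inl i) * ρ (Sum.inl j) := by
    intro i j
    have hi : 1 - ca ^ 2 ≤ ρ (Sum.inl i) ^ 2 := by rw [hρw]; nlinarith [hc_le i, hc0 i]
    have hj : 1 - ca ^ 2 ≤ ρ (Sum.inl j) ^ 2 := by rw [hρw]; nlinarith [hc_le j, hc0 j]
    have hsq2 : (1 - ca ^ 2) ^ 2 ≤ (ρ (Sum.inl i) * ρ (Sum.inl j)) ^ 2 := by
      rw [mul_pow, sq (1 - ca ^ 2)]; exact mul_le_mul hi hj h1ca.le (sq_nonneg _)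
    exact (pow_le_pow_iff_left₀ h1ca.le (mul_nonneg (hρ0 _) (hρ0 _)) two_ne_zero).1 hsq2
  have hsepθ : ∀ i j, i ≠ j → cos (θ (Sum.inl i) - θ (Sum.inl j)) ≤ σ₁ := by
    intro i j hij
    have h := hsep i j hij
    rw [hww] at h
    have hcc : cb ^ 2 ≤ ⟪v, w i⟫ * ⟪v, w j⟫ := by nlinarith [hcb_le i, hcb_le j, hcb0]
    have hKK : ρ (Sum.inl i) * ρ (Sum.inl j) * cos (θ (Sum.inl i) - θ (Sum.inl j)) ≤
        ca - cb ^ 2 := by linarith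
    rcases le_or_gt (cos (θ (Sum.inl i) - θ (Sum.inl j))) 0 with hneg | hpos
    · exact hneg.trans hσ0
    · rw [hσ₁, le_div_iff₀ h1ca]
      calc cos (θ (Sum.inl i) - θ (Sum.inl j)) * (1 - ca ^ 2)
          ≤ cos (θ (Sum.inl i) - θ (Sum.inl j)) * (ρ (Sum.inl i) * ρ (Sum.inl j)) :=
            mul_le_mul_of_nonneg_left (hρρlo i j) hpos.le
        _ ≤ ca - cb ^ 2 := by linarith
  -- bonds in the tangent circle (sharp bound): `K ≤ cos (θ i - θ j)`
  have hbondθ : ∀ i j, cb ≤ ⟪w i, w j⟫ → K ≤ cos (θ (Sum.inl i) - θ (Sum.inl j)) := by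
    intro i j hb
    rw [hww, add_comm] at hb
    exact corner_cos_lower hcb0 hca1 hsq hK hKs (hcb_le i) (hc_le i) (hc_le j) (hρ0 _) (hρw i)
      (hρ0 _) (hρw j) hb
  have hxθ : ∀ i, cb ≤ ⟪w i, x⟫ → K ≤ cos (θ (Sum.inl i) - θ (Sum.inr ())) := by
    intro i hb
    rw [hwx, add_comm] at hb
    exact corner_cos_lower hcb0 hca1 hsq hK hKs (hcb_le i) (hc_le i) hvx (hρ0 _) (hρw i)
      (hρ0 _) hρx hb
  -- the ends of the path are a double step apart
  have hx03 : 2 * K ^ 2 - 1 ≤ cos (θ (Sum.inl 0) - θ (Sum.inl 3)) := by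
    have := two_mul_sq_sub_one_le_cos_sub hK0.le (hxθ 0 hx0) (hxθ 3 hx3)
    rwa [sub_sub_sub_cancel_right] at this
  -- the angles
  set g₀ := arccos σ₁ with hg₀
  set g₁ := arccos K with hg₁
  have hσ1 : σ₁ ≤ 1 := by linarith
  have hcg₀ : cos g₀ = σ₁ := cos_arccos (by linarith) hσ1
  have hcg₁ : cos g₁ = K := cos_arccos (by linarith) hK1
  have hπ3 : π / 3 < g₀ := by
    have : arccos (1 / 2) = π / 3 :=
      arccos_eq_of_eq_cos (by positivity) (by linarith [pi_pos]) cos_pi_div_three.symm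
    rw [hg₀, ← this]
    exact arccos_lt_arccos (by linarith) hσ (by norm_num)
  have h2g₀ : 2 * g₀ ≤ π := by
    have := arccos_le_pi_div_two.2 hσ0
    rw [← hg₀] at this; linarith
  have hg₁0 : 0 ≤ g₁ := arccos_nonneg K
  have hg₁π : g₁ ≤ π := arccos_le_pi K
  have hg₁₀ : g₁ < 2 * g₀ := by
    by_contra h
    have h' : 2 * g₀ ≤ g₁ := not_lt.mp h
    have := cos_le_cos_of_nonneg_of_le_pi (by linarith [arccos_nonneg σ₁]) hg₁π h'
    rw [hcg₁, cos_two_mul, hcg₀] at this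
    linarith
  have h5 : 5 * g₁ < 2 * π := by
    by_contra h
    have h' : 2 * π / 5 ≤ g₁ := by linarith
    have := cos_le_cos_of_nonneg_of_le_pi (by positivity) hg₁π h'
    rw [hcg₁] at this
    linarith
  refine four_path_false hπ3 h2g₀ hg₁0 hg₁₀ h5 (fun k => θ (Sum.inl k)) (fun k => hθ _)
    (fun i j hij => ?_) ?_ ?_ ?_ ?_
  · rw [hcg₀]; exact hsepθ i j hij
  · rw [hcg₁, cos_sub_rev]; exact hbondθ 0 1 h01
  · rw [hcg₁, cos_sub_rev]; exact hbondθ 1 2 h12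
  · rw [hcg₁, cos_sub_rev]; exact hbondθ 2 3 h23
  · rw [cos_two_mul, hcg₁]; exact hx03

/-- `cos (2π/5) = (√5 − 1)/4`. [folklore] -/
theorem cos_two_pi_div_five : cos (2 * π / 5) = (Real.sqrt 5 - 1) / 4 := by
  have h : 2 * π / 5 = 2 * (π / 5) := by ring
  rw [h, cos_two_mul, cos_pi_div_five]
  have h5 : Real.sqrt 5 ^ 2 = 5 := Real.sq_sqrt (by norm_num)
  nlinarith [h5]

/-- **The `η = 1/100` instance.**  With `ca = 1 − 1/(2·(101/100)²)`, `cb = 1 − (101/100)²/2`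
(the angular window of `softFourRings_of_twelve_unit`) and `K = (cb − ca²)/(1 − ca²) = 0.3108 >
cos 72°`: no site direction has four neighbour directions bonded along a path whose ends are
bonded to a common fifth direction at least `arccos ca` away from the site. [folklore] -/
theorem no_three_triangles_quad_one_percent {v : EuclideanSpace ℝ (Fin 3)} (hv : ‖v‖ = 1)
    (w : Fin 4 → EuclideanSpace ℝ (Fin 3)) (hw : ∀ k, ‖w k‖ = 1) (x : EuclideanSpace ℝ (Fin 3))
    (hx : ‖x‖ = 1)
    (hvw : ∀ k, (1 - (101 / 100 : ℝ) ^ 2 / 2) ≤ ⟪v, w k⟫ ∧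
      ⟪v, w k⟫ ≤ 1 - 1 / (2 * (101 / 100 : ℝ) ^ 2))
    (hsep : ∀ i j, i ≠ j → ⟪w i, w j⟫ ≤ 1 - 1 / (2 * (101 / 100 : ℝ) ^ 2))
    (h01 : (1 - (101 / 100 : ℝ) ^ 2 / 2) ≤ ⟪w 0, w 1⟫)
    (h12 : (1 - (101 / 100 : ℝ) ^ 2 / 2) ≤ ⟪w 1, w 2⟫)
    (h23 : (1 - (101 / 100 : ℝ) ^ 2 / 2) ≤ ⟪w 2, w 3⟫)
    (hvx : ⟪v, x⟫ ≤ 1 - 1 / (2 * (101 / 100 : ℝ) ^ 2))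
    (hx0 : (1 - (101 / 100 : ℝ) ^ 2 / 2) ≤ ⟪w 0, x⟫)
    (hx3 : (1 - (101 / 100 : ℝ) ^ 2 / 2) ≤ ⟪w 3, x⟫) : False := by
  -- `ca = 5201/10201`, `cb = 9799/20000`, `K = (cb - ca²)/(1 - ca²) = 478679849399/1540200000000`
  have hK5 : cos (2 * π / 5) < (478679849399 / 1540200000000 : ℝ) := by
    rw [cos_two_pi_div_five]
    have h1 : Real.sqrt 5 < 4 * (478679849399 / 1540200000000 : ℝ) + 1 :=
      (Real.sqrt_lt' (by norm_num)).2 (by norm_num)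
    linarith
  exact no_three_triangles_quad (ca := 1 - 1 / (2 * (101 / 100 : ℝ) ^ 2))
    (cb := 1 - (101 / 100 : ℝ) ^ 2 / 2) (K := 478679849399 / 1540200000000) (by norm_num)
    (by norm_num) (by norm_num) (by norm_num) (by norm_num) (by norm_num) (by norm_num)
    (by norm_num) hK5 hv w hw x hx hvw hsep h01 h12 h23 hvx hx0 hx3

end Summit.AtomisticToContinuum.Crystallization.Theorems
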